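import Summits.BirchSwinnertonDyer.BirchSwinnertonDyer.Theorems.InertBadSignedBranchesInertBadAtThreeQuarticTorsionSums
import Literature.NumberTheory.EllipticCurves.WeierstrassPMultiplication
import Literature.NumberTheory.EllipticCurves.RealLatticePeriod
import Mathlib.RingTheory.Polynomial.ScaleRoots
import HarnessLib

/-!
# Prime-to-`3` torsion of `y² = x³ − x`: integral coordinates, `D(w) ≠ 0`, and the `3`-currency lemma

Summit `BirchSwinnertonDyer`, crux `InertBadAtThree` (stmt-BirchSwinnertonDyer-19225), line of record `rubin_e1_inert_three`
(registered stub `stub_neronIntegralThreeQuartic` v4 / `stub_plainOddNeronIntegralThreeQuartic` v5); sequel to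
`…InertBadAtThreeQuarticTorsionSums` (P4.0–P4.2). Piece **P5** of the stub plan
`Cruxes/InertBadAtThree/STUB-PLAN-neronIntegralThreeQuartic-bsd-idea-18-g8.md` plus the bookkeeping its P6a–c need, width seat
bsd-wall-cm-bed-w1 g7. `Λ = ℤi + ℤ`, `ϖ₀ = Γ(1/4)²/(2√(2π))`; the homothetic lattice `ϖ₀Λ` has `g₂ = 4`, `g₃ = 0`, i.e. its curve is
`A : y² = x³ − x`, uniformised by `x = ℘_Λ(w)/ϖ₀²`, `y = ℘'_Λ(w)/(2ϖ₀³)`.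

* `exists_not_three_dvd_isIntegral_div` — currency lemma: `a` an algebraic integer, `u ∈ ℤ`, `3 ∤ u` ⇒ `∃ s ∈ ℕ`, `3 ∤ s`,
  `s/(u + 3a)` an algebraic integer (`g(Y) = 3^d·minpoly_a((Y − u)/3)` is monic with root `u + 3a` and `g(0) ≡ (−u)^d (mod 3)`;
  `s = |g(0)|`). So the currency «`∃ s, 3 ∤ s, s·X` integral» of the registered stub is available for `X = 1/(u + 3a)`.
* `torsion_coord_isIntegral` (P5) — `w ∉ Λ`, `n w ∈ Λ`, `n ≠ 0` ⇒ `n²x(w)`, `n³y(w)` are algebraic integers (`x(w)` is a root of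
  `ΨSqₙ ∈ ℤ[X]` of `⟨0,0,0,−1,0⟩`, leading coefficient `n²` — Mathlib `WeierstrassCurve.leadingCoeff_ΨSq`, tree
  `PeriodPair.aeval_weierstrassP_ΨSq_eq_zero` on `ϖ₀Λ`, `isIntegral_leadingCoeff_smul`; `(n³y)² = (n²x)³ − n⁴(n²x)`).
  (Silverman AEC VII.3.4 / Cassels is the sharper local statement; not needed.)
* `three_mul_notMem`, `threeDiv_ne_zero` — `w ∉ Λ`, `n w ∈ Λ`, `3 ∤ n` ⇒ `3w ∉ Λ` (Bézout) ⇒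
  `D(w) = 3℘⁴ − 6ϖ₀⁴℘² − ϖ₀⁸ = 3(℘(w)² − ℘(1/3)²)(℘(w)² − ℘((1+i)/3)²) ≠ 0` (`PeriodPair.weierstrassP_eq_weierstrassP_iff`).

HONEST FRAMING: nothing here proves the registered stub, the crux `InertBadAtThree`, any instance of F-es-18, or BSD. No definitions,
no named facts; axioms standard.
-/

set_option linter.dupNamespace false

noncomputable section

open Complex PeriodPair Real Set Filter Polynomial
open scoped Real Topology PeriodPair ComplexConjugate

namespace Summit.BirchSwinnertonDyer.BirchSwinnertonDyer.Theorems.InertBadSignedBranchesInertBadAtThreeQuarticTorsionCoordinates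

open Literature.NumberTheory.EllipticCurves Literature.NumberTheory.EllipticCurves.GaussianLattice
open Summit.BirchSwinnertonDyer.BirchSwinnertonDyer.Theorems.InertBadSignedBranchesInertBadAtThreeQuarticTorsionSums

/-! ### The currency lemma: `s/(u + 3a)` is integral for some `3 ∤ s` -/

/-- **Currency lemma.** For an algebraic integer `a ∈ ℂ` and `u ∈ ℤ` with `3 ∤ u` there is `s ∈ ℕ` with `3 ∤ s` such that
`s / (u + 3a)` is an algebraic integer. (With `f = minpoly_ℤ(a)` of degree `d`, the monic `g(Y) = 3^d f((Y−u)/3) ∈ ℤ[Y]`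
(`scaleRoots` by `3`, then translation by `u`) has root `δ = u + 3a` and `g(0) ≡ (−u)^d (mod 3)`; `s = |g(0)|` and
`s/δ = ∓ g.divX(δ)`.) If `u + 3a = 0` the quotient is `0` by convention and the claim is trivial. -/
theorem exists_not_three_dvd_isIntegral_div {a : ℂ} (ha : IsIntegral ℤ a) {u : ℤ} (hu : ¬ (3 : ℤ) ∣ u) :
    ∃ s : ℕ, ¬ 3 ∣ s ∧ IsIntegral ℤ ((s : ℂ) / ((u : ℂ) + 3 * a)) := by
  set δ : ℂ := (u : ℂ) + 3 * a with hδdef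
  -- the monic polynomial with root `δ`
  set f : ℤ[X] := minpoly ℤ a with hf
  have hfm : f.Monic := minpoly.monic ha
  set p₁ : ℤ[X] := f.scaleRoots 3 with hp₁
  have hp₁m : p₁.Monic := (monic_scaleRoots_iff 3).mpr hfm
  have hp₁root : aeval (3 * a) p₁ = 0 := by
    have h := scaleRoots_aeval_eq_zero (A := ℂ) (r := (3 : ℤ)) (minpoly.aeval ℤ a)
    simpa using h
  set g : ℤ[X] := p₁.comp (X - C u) with hg
  have hgroot : aeval δ g = 0 := by
    rw [hg, aeval_comp]
    have hlin : aeval δ (X - C u : ℤ[X]) = 3 * a := by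
      simp [hδdef]
    rw [hlin]
    exact hp₁root
  -- `g(0) = p₁(-u) ≡ (-u)^d (mod 3)`
  have hg0 : g.coeff 0 = p₁.eval (-u) := by
    rw [coeff_zero_eq_eval_zero, hg, eval_comp]
    simp
  set d := f.natDegree with hd
  have hdeg : p₁.natDegree = d := natDegree_scaleRoots f 3
  have heval : p₁.eval (-u) = (∑ i ∈ Finset.range d, f.coeff i * 3 ^ (d - i) * (-u) ^ i) + (-u) ^ d := by
    rw [eval_eq_sum_range, hdeg, Finset.sum_range_succ]
    congr 1
    · refine Finset.sum_congr rfl fun i _ ↦ ?_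
      rw [hp₁, coeff_scaleRoots]
    · rw [hp₁, coeff_scaleRoots, ← hd, Nat.sub_self, pow_zero, mul_one]
      rw [show f.coeff d = 1 from hfm.coeff_natDegree, one_mul]
  have h3dvd : (3 : ℤ) ∣ ∑ i ∈ Finset.range d, f.coeff i * 3 ^ (d - i) * (-u) ^ i := by
    refine Finset.dvd_sum fun i hi ↦ ?_
    have hi' : d - i ≠ 0 := Nat.sub_ne_zero_of_lt (Finset.mem_range.mp hi)
    exact dvd_mul_of_dvd_left (dvd_mul_of_dvd_right (dvd_pow_self 3 hi') _) _
  have hg0_not : ¬ (3 : ℤ) ∣ g.coeff 0 := by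
    rw [hg0, heval]
    intro h
    have h' : (3 : ℤ) ∣ (-u) ^ d := by simpa using dvd_sub h h3dvd
    exact hu ((dvd_neg).mp (Int.prime_three.dvd_of_dvd_pow h'))
  -- `δ` is integral, hence so is `g.divX (δ)`
  have hδint : IsIntegral ℤ δ := by
    have h1 : IsIntegral ℤ ((u : ℂ)) := by
      simpa using isIntegral_algebraMap (R := ℤ) (A := ℂ) (x := u)
    have h3 : IsIntegral ℤ (((3 : ℤ) : ℂ)) := by
      simpa using isIntegral_algebraMap (R := ℤ) (A := ℂ) (x := (3 : ℤ))
    have h2 : IsIntegral ℤ ((3 : ℂ) * a) := by simpa using h3.mul ha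
    exact h1.add h2
  have hdivX : IsIntegral ℤ (aeval δ g.divX) := by
    have hδmem : δ ∈ integralClosure ℤ ℂ := hδint
    have hmem : aeval δ g.divX ∈ integralClosure ℤ ℂ :=
      Algebra.adjoin_le (Set.singleton_subset_iff.mpr hδmem) (aeval_mem_adjoin_singleton ℤ δ)
    exact hmem
  -- `g(0)/δ = -g.divX(δ)`
  have hkey : IsIntegral ℤ (((g.coeff 0 : ℤ) : ℂ) / δ) := by
    by_cases hδ0 : δ = 0
    · rw [hδ0, div_zero]; exact isIntegral_zero
    · have hsplit : aeval δ g = δ * aeval δ g.divX + (g.coeff 0 : ℂ) := by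
        conv_lhs => rw [← X_mul_divX_add g]
        simp [map_add, map_mul, aeval_X]
      rw [hgroot] at hsplit
      have : ((g.coeff 0 : ℤ) : ℂ) / δ = -aeval δ g.divX := by
        rw [div_eq_iff hδ0]; linear_combination -hsplit
      rw [this]
      exact hdivX.neg
  refine ⟨(g.coeff 0).natAbs, fun h ↦ hg0_not (Int.ofNat_dvd_left.mpr h), ?_⟩
  rcases Int.natAbs_eq (g.coeff 0) with h | h
  · have hz : (((g.coeff 0).natAbs : ℕ) : ℤ) = g.coeff 0 := by omega
    have : (((g.coeff 0).natAbs : ℕ) : ℂ) = ((g.coeff 0 : ℤ) : ℂ) := by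
      rw [← Int.cast_natCast, hz]
    rw [this]; exact hkey
  · have hz : (((g.coeff 0).natAbs : ℕ) : ℤ) = -g.coeff 0 := by omega
    have : (((g.coeff 0).natAbs : ℕ) : ℂ) = -((g.coeff 0 : ℤ) : ℂ) := by
      rw [← Int.cast_natCast, hz, Int.cast_neg]
    rw [this, neg_div]; exact hkey.neg

/-! ### P5: prime-to-`n`… torsion coordinates of `y² = x³ − x` times `n², n³` are integral -/

/-- `ϖ₀ ≠ 0` in `ℂ`. -/
private theorem varpi_ne_zero' : ((Real.Gamma (1 / 4) ^ 2 / (2 * Real.sqrt (2 * π)) : ℝ) : ℂ) ≠ 0 :=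
  Complex.ofReal_ne_zero.mpr varpi_pos.ne'

/-- **P5 — torsion coordinates are integral up to the order.** If `w ∉ Λ`, `n·w ∈ Λ`, `n ≠ 0`, then
`n² · ℘(w)/ϖ₀²` and `n³ · ℘'(w)/(2ϖ₀³)` are algebraic integers: `x = ℘(w)/ϖ₀²` is a root of the division polynomial `ΨSqₙ ∈ ℤ[X]`
of `⟨0,0,0,−1,0⟩` (the curve of the lattice `ϖ₀Λ`), with leading coefficient `n²`, and `(n³y)² = (n²x)³ − n⁴(n²x)` for
`y = ℘'(w)/(2ϖ₀³)`. -/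
theorem torsion_coord_isIntegral {w : ℂ} {n : ℕ} (hw : w ∉ (ofUpperHalfPlane UpperHalfPlane.I).lattice) (hn : ((n : ℂ) * w) ∈ (ofUpperHalfPlane UpperHalfPlane.I).lattice)
    (hn0 : n ≠ 0) :
    IsIntegral ℤ ((n : ℂ) ^ 2 * (℘[ofUpperHalfPlane UpperHalfPlane.I] w / ((Real.Gamma (1 / 4) ^ 2 / (2 * Real.sqrt (2 * π)) : ℝ) : ℂ) ^ 2)) ∧
      IsIntegral ℤ ((n : ℂ) ^ 3 * (℘'[ofUpperHalfPlane UpperHalfPlane.I] w / (2 * ((Real.Gamma (1 / 4) ^ 2 / (2 * Real.sqrt (2 * π)) : ℝ) : ℂ) ^ 3))) := by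
  set ϖ : ℂ := ((Real.Gamma (1 / 4) ^ 2 / (2 * Real.sqrt (2 * π)) : ℝ) : ℂ) with hϖ
  have hϖ0 : ϖ ≠ 0 := varpi_ne_zero'
  set L' : PeriodPair := (ofUpperHalfPlane UpperHalfPlane.I).mulLeft ϖ hϖ0 with hL'
  have hg2 : L'.g₂ = 4 := by
    rw [hL', PeriodPair.g₂_mulLeft, g₂_eq_varpi', ← hϖ]
    field_simp
  have hg3 : L'.g₃ = 0 := by
    rw [hL', PeriodPair.g₃_mulLeft, g₃_ofUpperHalfPlane_I, mul_zero]
  have hW : (⟨0, 0, 0, -1, 0⟩ : WeierstrassCurve ℤ).map (algebraMap ℤ ℂ) = L'.curve :=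
    PeriodPair.map_eq_curve (by rw [hg2]; norm_num) (by rw [hg3]; norm_num)
  have hw' : ϖ * w ∉ L'.lattice := by
    rw [hL', PeriodPair.mul_mem_mulLeft_lattice]; exact hw
  have hnw' : ((n : ℤ) : ℂ) * (ϖ * w) ∈ L'.lattice := by
    rw [show ((n : ℤ) : ℂ) * (ϖ * w) = ϖ * ((n : ℂ) * w) by push_cast; ring, hL',
      PeriodPair.mul_mem_mulLeft_lattice]
    exact hn
  have hroot := PeriodPair.aeval_weierstrassP_ΨSq_eq_zero hW hw' hnw'
  have hPw : ℘[L'] (ϖ * w) = ℘[ofUpperHalfPlane UpperHalfPlane.I] w / ϖ ^ 2 := by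
    rw [hL', PeriodPair.weierstrassP_mulLeft, div_eq_inv_mul]
  rw [hPw] at hroot
  have hlc := (⟨0, 0, 0, -1, 0⟩ : WeierstrassCurve ℤ).leadingCoeff_ΨSq (n := (n : ℤ)) (by simp [hn0])
  have hX : IsIntegral ℤ ((n : ℂ) ^ 2 * (℘[ofUpperHalfPlane UpperHalfPlane.I] w / ϖ ^ 2)) := by
    have h := isIntegral_leadingCoeff_smul _ _ hroot
    rw [hlc, zsmul_eq_mul] at h
    simpa using h
  refine ⟨hX, ?_⟩
  -- `(n³y)² = (n²x)³ − n⁴(n²x)`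
  have hQ2 := (ofUpperHalfPlane UpperHalfPlane.I).derivWeierstrassP_sq w hw
  rw [g₂_eq_varpi', g₃_ofUpperHalfPlane_I, sub_zero, ← hϖ] at hQ2
  have hY2 : ((n : ℂ) ^ 3 * (℘'[ofUpperHalfPlane UpperHalfPlane.I] w / (2 * ϖ ^ 3))) ^ 2 =
      ((n : ℂ) ^ 2 * (℘[ofUpperHalfPlane UpperHalfPlane.I] w / ϖ ^ 2)) ^ 3 - (n : ℂ) ^ 4 * ((n : ℂ) ^ 2 * (℘[ofUpperHalfPlane UpperHalfPlane.I] w / ϖ ^ 2)) := by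
    field_simp
    linear_combination hQ2
  refine IsIntegral.of_pow two_pos ?_
  rw [hY2]
  have h4 : IsIntegral ℤ ((n : ℂ) ^ 4) :=
    (by simpa using isIntegral_algebraMap (R := ℤ) (A := ℂ) (x := (n : ℤ)) : IsIntegral ℤ (n : ℂ)).pow 4
  exact (hX.pow 3).sub (h4.mul hX)

/-! ### `3w ∉ Λ` and `D(w) ≠ 0` on prime-to-`3` torsion -/

/-- If `w ∉ Λ`, `n w ∈ Λ` and `3 ∤ n` then `3w ∉ Λ` (Bézout). -/
theorem three_mul_notMem {w : ℂ} {n : ℕ} (hw : w ∉ (ofUpperHalfPlane UpperHalfPlane.I).lattice) (hn : ((n : ℂ) * w) ∈ (ofUpperHalfPlane UpperHalfPlane.I).lattice)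
    (h3 : ¬ 3 ∣ n) : (3 : ℂ) * w ∉ (ofUpperHalfPlane UpperHalfPlane.I).lattice := by
  intro h3w
  have hcop : IsCoprime (3 : ℤ) (n : ℤ) := by
    have hc : Nat.Coprime 3 n := (Nat.Prime.coprime_iff_not_dvd Nat.prime_three).mpr h3
    exact Int.isCoprime_iff_gcd_eq_one.mpr hc
  obtain ⟨a, b, hab⟩ := hcop
  apply hw
  have : w = (a : ℂ) * ((3 : ℂ) * w) + (b : ℂ) * ((n : ℂ) * w) := by
    have hab' : (a : ℂ) * 3 + (b : ℂ) * (n : ℂ) = 1 := by exact_mod_cast hab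
    linear_combination (-w) * hab'
  rw [this]
  exact add_mem (by simpa [zsmul_eq_mul] using (ofUpperHalfPlane UpperHalfPlane.I).lattice.smul_mem a h3w)
    (by simpa [zsmul_eq_mul] using (ofUpperHalfPlane UpperHalfPlane.I).lattice.smul_mem b hn)

/-- **`D(w) ≠ 0` when `3w ∉ Λ`** (`w ∉ Λ`): `D(w) = 3(℘(w)² − ℘(1/3)²)(℘(w)² − ℘((1+i)/3)²)` and `℘(w) = ±℘(v)`, `v` a
`3`-division point, would force `w ≡ ±v` or `w ≡ ±iv`, hence `3w ∈ Λ` (`PeriodPair.weierstrassP_eq_weierstrassP_iff`,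
`℘(iz) = −℘(z)`). -/
theorem threeDiv_ne_zero {w : ℂ} (hw : w ∉ (ofUpperHalfPlane UpperHalfPlane.I).lattice) (h3 : (3 : ℂ) * w ∉ (ofUpperHalfPlane UpperHalfPlane.I).lattice) :
    3 * ℘[ofUpperHalfPlane UpperHalfPlane.I] w ^ 4 - 6 * ((Real.Gamma (1 / 4) ^ 2 / (2 * Real.sqrt (2 * π)) : ℝ) : ℂ) ^ 4 * ℘[ofUpperHalfPlane UpperHalfPlane.I] w ^ 2 - ((Real.Gamma (1 / 4) ^ 2 / (2 * Real.sqrt (2 * π)) : ℝ) : ℂ) ^ 8 ≠ 0 := by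
  set P := ℘[ofUpperHalfPlane UpperHalfPlane.I] w with hP
  set P₁ := ℘[ofUpperHalfPlane UpperHalfPlane.I] (1 / 3) with hP₁
  set P₂ := ℘[ofUpperHalfPlane UpperHalfPlane.I] ((1 + I) / 3) with hP₂
  set ϖ : ℂ := ((Real.Gamma (1 / 4) ^ 2 / (2 * Real.sqrt (2 * π)) : ℝ) : ℂ) with hϖ
  set s : ℂ := (Real.sqrt 3 : ℂ) with hs
  have hs2 : s ^ 2 = 3 := by
    rw [hs, ← Complex.ofReal_pow, Real.sq_sqrt (by norm_num)]; push_cast; ring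
  have h1 : P₁ ^ 2 = (3 + 2 * s) / 3 * ϖ ^ 4 := by
    rw [hP₁, weierstrassP_third_sq, hs, hϖ]; push_cast; ring
  have h2 : P₂ ^ 2 = (3 - 2 * s) / 3 * ϖ ^ 4 := by
    rw [hP₂, weierstrassP_one_add_I_third_sq, hs, hϖ]; push_cast; ring
  have hfac : 3 * P ^ 4 - 6 * ϖ ^ 4 * P ^ 2 - ϖ ^ 8 = 3 * (P ^ 2 - P₁ ^ 2) * (P ^ 2 - P₂ ^ 2) := by
    rw [h1, h2]; linear_combination (4 / 3 : ℂ) * ϖ ^ 8 * hs2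
  -- if `℘(w) = ℘(v)` for a `3`-division point `v` then `3w ∈ Λ`
  have key : ∀ v : ℂ, v ∉ (ofUpperHalfPlane UpperHalfPlane.I).lattice → (3 : ℂ) * v ∈ (ofUpperHalfPlane UpperHalfPlane.I).lattice → ℘[ofUpperHalfPlane UpperHalfPlane.I] w ≠ ℘[ofUpperHalfPlane UpperHalfPlane.I] v := by
    intro v hv h3v heq
    rcases ((ofUpperHalfPlane UpperHalfPlane.I).weierstrassP_eq_weierstrassP_iff hw hv).mp heq with h | h
    · exact h3 (by
        have := sub_mem ((ofUpperHalfPlane UpperHalfPlane.I).lattice.smul_mem (3 : ℤ) h) h3v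
        simpa [zsmul_eq_mul, mul_add] using this)
    · exact h3 (by
        have := add_mem ((ofUpperHalfPlane UpperHalfPlane.I).lattice.smul_mem (3 : ℤ) h) h3v
        simpa [zsmul_eq_mul, mul_sub] using this)
  have k1 := key (1 / 3) one_third_notMem (by rw [show (3 : ℂ) * (1 / 3) = 1 by norm_num]; exact one_mem)
  have k2 := key (I / 3) I_third_notMem (by rw [show (3 : ℂ) * (I / 3) = I by ring]; exact I_mem)
  have k3 := key ((1 + I) / 3) one_add_I_third_notMem
    (by rw [show (3 : ℂ) * ((1 + I) / 3) = 1 + I by ring]; exact one_add_I_mem)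
  have k4 := key ((1 - I) / 3) one_sub_I_third_notMem
    (by rw [show (3 : ℂ) * ((1 - I) / 3) = 1 - I by ring]; exact one_sub_I_mem)
  rw [weierstrassP_I_third, ← hP, ← hP₁] at k2
  rw [weierstrassP_one_sub_I_third, ← hP, ← hP₂] at k4
  rw [← hP, ← hP₁] at k1
  rw [← hP, ← hP₂] at k3
  rw [hfac]
  refine mul_ne_zero (mul_ne_zero three_ne_zero ?_) ?_
  · intro h
    have : (P - P₁) * (P + P₁) = 0 := by linear_combination h
    rcases mul_eq_zero.mp this with h' | h'
    · exact k1 (sub_eq_zero.mp h')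
    · exact k2 (by linear_combination h')
  · intro h
    have : (P - P₂) * (P + P₂) = 0 := by linear_combination h
    rcases mul_eq_zero.mp this with h' | h'
    · exact k3 (sub_eq_zero.mp h')
    · exact k4 (by linear_combination h')

end Summit.BirchSwinnertonDyer.BirchSwinnertonDyer.Theorems.InertBadSignedBranchesInertBadAtThreeQuarticTorsionCoordinates
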